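import Summits.CriticalPhenomena.PercolationContinuityZ3.Theorems.PercNearOneGluingNoHeavyLowerTailCSHLevelForms
import Summits.CriticalPhenomena.PercolationContinuityZ3.Theorems.PercNearOneGluingNoHeavyLowerTailCSHPsiDefs
import HarnessLib

/-!
# Pinned hierarchy (PIN-CSH) — the pointwise unfolding identity of Lemma U with a PINNED ROW (level-form algebra only)

Definitions file (`--supports stmt-CriticalPhenomena-4575`), route task `nh-dp-fatminority` (line fat-minority-linear, gen 16); memo
`run/shared/lean/prim/prim-nh-dp-fatminority/CSH-PSI-MEMO.md` §2 ((E), (E′), Lemma U_ψ).  Pure algebra over prim-hp-8's level forms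
`CSH.slForm` and prim-ineq-prove-1's abstract indicators `CSH.chi / jn / av / unfoldT / unfoldK` (`…CSHLevelForms.lean`); no measure theory,
no named facts, no sorries.  Fourth brick of the Lean proof of memo THEOREM 1_ψ (`PinCSH.Holds`).

SETTING.  An abstract symmetric transitive relation `R` on `V` (open reachability in a world configuration), a LABEL `o : V` (never a decoy,
never the owner) and an abstract PINNED PREDICATE `Hc : V → Prop` ("`ψ(C_u) = 1`"; in the application `Hc u ⟺ u R o ∧ C_u ∈ 𝓗`) which is
CLOSED under `R` (`Hc a → R a b → Hc b`) and EXCLUSIVE (`Hc a → Hc b → R a b` — memo (E): two pinned clusters both contain `o`).  The pinned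
rows are encoded by ONE relation `PinCSH.prel R Hc o`, equal to `R` off the label and to `Hc` AT the label (`prel o d ⟺ Hc d`), so that the
row functions of the memo are LITERALLY the abstract indicators of `…CSHLevelForms.lean` for `prel`:
`CSH.chi prel u d` = `1{u ∈ C_d}` (`u ≠ o`) / `ψ(C_d)` (`u = o`); `CSH.jn prel S u` = `1{u ↔ S}` / `J^ψ_S = 1{∃ s ∈ S, ψ(C_s) = 1}`;
`CSH.av prel S d = CSH.av R S d` (decoys `≠ o`).  `prel` is neither symmetric nor transitive, but the ONE identity the CLAIM needs, the disjoint
split `J_{S ∪ d}(u) = J_S(u) + χ_d(u)·ε_S(d)` (`jn_prel_insert`), holds: off the label it is `CSH.jn_insert`, at the label it is the memo's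
(E′) `J^ψ_{S∪d} = J^ψ_S + ψ(C_d)·1{d ↮ S}` — by closedness and exclusivity.  Hence THE POINTWISE CLAIM OF LEMMA U_ψ
(`slForm_prel_jn`): `sl_L[jn prel S](u) = jn prel (S ∪ decoys L)(u) − unfoldT prel S L(u) + unfoldK L(u)` with the SAME configuration-free
remainder `CSH.unfoldK`, and off the label the unfolded terms are the pure ones (`unfoldT_prel_of_ne`).
[cite: KozmaNitzan2024, Conj. 4 (p. 32), Question 7 (p. 36)] [cite: VandenbergHaggstromKahn2005, Thm. 1.3 (p. 6)]
-/

noncomputable section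

namespace Summit.CriticalPhenomena.PercolationContinuityZ3.Theorems

open Literature.Probability.Percolation (openGraph openEdgeCluster)
open scoped Classical
open CSH

namespace PinCSH

variable {V : Type*}

section Unfold

variable (R : V → V → Prop) (Hc : V → Prop) (o : V)

/-- **The pinned row relation**: `prel u d ⟺ R u d` for a genuine vertex `u ≠ o`, and `prel o d ⟺ Hc d` ("the pinned test of `C_d` holds")
at the label. (transcription of the memo prim-nh-dp-fatminority CSH-PSI-MEMO.md §2, the ψ-row) [folklore] -/
def prel (u d : V) : Prop := if u = o then Hc d else R u d

/-- Off the label the pinned relation is `R`. [folklore] -/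
theorem prel_of_ne {u : V} (hu : u ≠ o) (d : V) : prel R Hc o u d ↔ R u d := by
  simp [prel, hu]

/-- At the label the pinned relation is the pinned predicate. [folklore] -/
theorem prel_label (d : V) : prel R Hc o o d ↔ Hc d := by
  simp [prel]

/-- Off the label: `χ^{prel}_d(u) = χ_d(u)`. [folklore] -/
theorem chi_prel_of_ne {u : V} (hu : u ≠ o) (d : V) : chi (prel R Hc o) u d = chi R u d := by
  unfold chi; rw [propext (prel_of_ne R Hc o hu d)]

/-- At the label: `χ^{prel}_d(o) = 1{Hc d} = ψ(C_d)`. [folklore] -/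
theorem chi_prel_label (d : V) : chi (prel R Hc o) o d = if Hc d then 1 else 0 := by
  unfold chi; rw [propext (prel_label R Hc o d)]

/-- For a decoy `d ≠ o`: `ε^{prel}_S(d) = ε_S(d)`. [folklore] -/
theorem av_prel (S : Set V) {d : V} (hd : d ≠ o) : av (prel R Hc o) S d = av R S d := by
  unfold av
  have : (∀ s ∈ S, ¬ prel R Hc o d s) ↔ (∀ s ∈ S, ¬ R d s) := forall₂_congr fun s _ => by rw [prel_of_ne R Hc o hd]
  rw [propext this]

/-- Off the label: `J^{prel}_S(u) = J_S(u)`. [folklore] -/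
theorem jn_prel_of_ne (S : Set V) {u : V} (hu : u ≠ o) : jn (prel R Hc o) S u = jn R S u := by
  unfold jn
  have : (∃ s ∈ S, prel R Hc o u s) ↔ (∃ s ∈ S, R u s) := exists_congr fun s => by rw [prel_of_ne R Hc o hu]
  rw [propext this]

/-- At the label: `J^{prel}_S(o) = J^ψ_S = 1{∃ s ∈ S, Hc s}`. [folklore] -/
theorem jn_prel_label (S : Set V) : jn (prel R Hc o) S o = if ∃ s ∈ S, Hc s then 1 else 0 := by
  unfold jn
  have : (∃ s ∈ S, prel R Hc o o s) ↔ (∃ s ∈ S, Hc s) := exists_congr fun s => by rw [prel_label R Hc o]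
  rw [propext this]

/-- **(E′) — the disjoint split with a pinned row**: for a decoy `d ≠ o`,
`J^{prel}_{S ∪ {d}}(u) = J^{prel}_S(u) + χ^{prel}_d(u)·ε_S(d)`; off the label this is `CSH.jn_insert` (symmetry + transitivity of `R`), at the
label it is `J^ψ_{S∪d} = J^ψ_S + ψ(C_d)·1{d ↮ S}`, by closedness (`Hc d`, `d R s` ⟹ `Hc s`) and EXCLUSIVITY (`Hc d`, `Hc s` ⟹ `d R s`).
(transcription of the memo prim-nh-dp-fatminority CSH-PSI-MEMO.md §2 (E′)) [folklore] -/
theorem jn_prel_insert (hRs : ∀ a b, R a b → R b a) (hRt : ∀ a b c, R a b → R b c → R a c)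
    (hH : ∀ a b, Hc a → R a b → Hc b) (hE : ∀ a b, Hc a → Hc b → R a b) (S : Set V) {d : V} (hd : d ≠ o) (u : V) :
    jn (prel R Hc o) (insert d S) u = jn (prel R Hc o) S u + chi (prel R Hc o) u d * av (prel R Hc o) S d := by
  rw [av_prel R Hc o S hd]
  by_cases hu : u = o
  · subst hu
    rw [jn_prel_label, jn_prel_label, chi_prel_label]
    unfold av
    by_cases h1 : ∃ s ∈ S, Hc s
    · obtain ⟨s, hs, hcs⟩ := h1
      rw [if_pos ⟨s, Set.mem_insert_of_mem _ hs, hcs⟩, if_pos ⟨s, hs, hcs⟩]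
      by_cases h2 : Hc d
      · rw [if_pos h2, if_neg (fun h' => h' s hs (hE d s h2 hcs))]; ring
      · rw [if_neg h2]; ring
    · rw [if_neg h1]
      by_cases h2 : Hc d
      · rw [if_pos ⟨d, Set.mem_insert _ _, h2⟩, if_pos h2, if_pos (fun s hs hds => h1 ⟨s, hs, hH d s h2 hds⟩)]
        ring
      · rw [if_neg h2, if_neg (by
          rintro ⟨s, hs, hcs⟩
          rcases Set.mem_insert_iff.1 hs with rfl | hs
          · exact h2 hcs
          · exact h1 ⟨s, hs, hcs⟩)]
        ring
  · rw [jn_prel_of_ne R Hc o _ hu, jn_prel_of_ne R Hc o _ hu, chi_prel_of_ne R Hc o hu, jn_insert R hRs hRt S d u]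

/-- **One level step on the pinned row function** (`d ≠ o`):
`slStep (d,c) (jn prel S) = jn prel (S ∪ {d}) − c − ε_S(d)·(χ^{prel}_d − c)`.
(transcription of the memo prim-nh-dp-fatminority CSH-PSI-MEMO.md §2, Lemma U_ψ induction step) [folklore] -/
theorem slStep_prel_jn (hRs : ∀ a b, R a b → R b a) (hRt : ∀ a b c, R a b → R b c → R a c)
    (hH : ∀ a b, Hc a → R a b → Hc b) (hE : ∀ a b, Hc a → Hc b → R a b) (S : Set V) {d : V} (hd : d ≠ o) (c : V → ℝ) :
    slStep (d, c) (jn (prel R Hc o) S) =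
      jn (prel R Hc o) (insert d S) - c - av (prel R Hc o) S d • (fun w => chi (prel R Hc o) w d - c w) := by
  funext u
  simp only [slStep, Pi.sub_apply, Pi.smul_apply, smul_eq_mul]
  rw [jn_prel_insert R Hc o hRs hRt hH hE S hd u, jn_eq_one_sub_av (prel R Hc o) S d]
  ring

/-- **THE POINTWISE CLAIM OF LEMMA U_ψ** (memo §2): for a symmetric transitive `R`, a pinned predicate closed under `R` and exclusive, and a
decoy list avoiding the label, `sl_L[jn prel S](u) = jn prel (S ∪ decoys(L))(u) − unfoldT prel S L(u) + unfoldK L(u)` with the SAME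
configuration-free remainder `CSH.unfoldK` as in the pure CLAIM `CSH.slForm_jn`.
(transcription of the memo prim-nh-dp-fatminority CSH-PSI-MEMO.md §2 Lemma U_ψ, CLAIM) [folklore] -/
theorem slForm_prel_jn (hRs : ∀ a b, R a b → R b a) (hRt : ∀ a b c, R a b → R b c → R a c)
    (hH : ∀ a b, Hc a → R a b → Hc b) (hE : ∀ a b, Hc a → Hc b → R a b)
    (L : List (V × (V → ℝ))) (hL : ∀ dc ∈ L, dc.1 ≠ o) (S : Set V) (u : V) :
    slForm L (jn (prel R Hc o) S) u =
      jn (prel R Hc o) (S ∪ {d | d ∈ L.map Prod.fst}) u - unfoldT (prel R Hc o) S L u + unfoldK L u := by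
  induction L generalizing S u with
  | nil => simp [unfoldT, unfoldK]
  | cons dc L ih =>
      obtain ⟨d, c⟩ := dc
      have hd : d ≠ o := hL (d, c) List.mem_cons_self
      have hL' : ∀ dc ∈ L, dc.1 ≠ o := fun dc hdc => hL dc (List.mem_cons_of_mem _ hdc)
      rw [slForm_cons_eq, slStep_prel_jn R Hc o hRs hRt hH hE S hd c, slForm_sub, slForm_sub, slForm_smul]
      simp only [Pi.sub_apply, Pi.smul_apply, smul_eq_mul, ih hL' (insert d S) u, unfoldT, unfoldK]
      have hset : insert d S ∪ {d' | d' ∈ L.map Prod.fst} = S ∪ {d' | d' ∈ ((d, c) :: L).map Prod.fst} := by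
        ext a
        simp only [Set.mem_union, Set.mem_insert_iff, Set.mem_setOf_eq, List.map_cons, List.mem_cons]
        tauto
      rw [hset]
      ring

/-- **Centred form of the CLAIM at the owner** (`J_{{x}} = χ_x`): `sl_L[χ^{prel}_x](u) + unfoldT prel {x} L(u) − J^{prel}_{{x}∪decoys}(u) = unfoldK L(u)`
is configuration-free. (transcription of the memo prim-nh-dp-fatminority CSH-PSI-MEMO.md §2 Lemma U_ψ) [folklore] -/
theorem slForm_prel_chi_add_unfoldT_sub_jn (hRs : ∀ a b, R a b → R b a) (hRt : ∀ a b c, R a b → R b c → R a c)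
    (hH : ∀ a b, Hc a → R a b → Hc b) (hE : ∀ a b, Hc a → Hc b → R a b)
    (L : List (V × (V → ℝ))) (hL : ∀ dc ∈ L, dc.1 ≠ o) (x u : V) :
    slForm L (fun w => chi (prel R Hc o) w x) u + unfoldT (prel R Hc o) {x} L u -
        jn (prel R Hc o) ({x} ∪ {d | d ∈ L.map Prod.fst}) u = unfoldK L u := by
  have h := slForm_prel_jn R Hc o hRs hRt hH hE L hL {x} u
  have e : (fun w => chi (prel R Hc o) w x) = jn (prel R Hc o) {x} := funext fun w => (jn_singleton (prel R Hc o) x w).symm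
  rw [e, h]; ring

/-- **The rows of genuine vertices unfold as in the pure hierarchy**: off the label, `unfoldT prel S L(u) = unfoldT R S L(u)` (the level form
`sl_{L'}` only reads its argument at `u` and at the decoys, none of which is the label). [folklore] -/
theorem unfoldT_prel_of_ne (L : List (V × (V → ℝ))) (hL : ∀ dc ∈ L, dc.1 ≠ o) (S : Set V) {u : V} (hu : u ≠ o) :
    unfoldT (prel R Hc o) S L u = unfoldT R S L u := by
  induction L generalizing S with
  | nil => rfl
  | cons dc L ih =>
      obtain ⟨d, c⟩ := dc
      have hd : d ≠ o := hL (d, c) List.mem_cons_self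
      have hL' : ∀ dc ∈ L, dc.1 ≠ o := fun dc hdc => hL dc (List.mem_cons_of_mem _ hdc)
      simp only [unfoldT, ih hL' (insert d S), av_prel R Hc o S hd]
      congr 2
      exact slForm_congr L (by rw [chi_prel_of_ne R Hc o hu]) fun dc hdc => by rw [chi_prel_of_ne R Hc o (hL' dc hdc)]

/-- The pinned row function at the owner's singleton source set: `J^{prel}_{{x}}(u) = χ^{prel}_x(u)` is `1{Hc x}` at the label and `χ_x(u)`
elsewhere. [folklore] -/
theorem jn_prel_singleton (x u : V) :
    jn (prel R Hc o) {x} u = if u = o then (if Hc x then (1 : ℝ) else 0) else chi R u x := by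
  rw [jn_singleton]
  by_cases hu : u = o
  · subst hu; rw [if_pos rfl, chi_prel_label]
  · rw [if_neg hu, chi_prel_of_ne R Hc o hu]

end Unfold

/-! ### The pinned predicate of a configuration -/

/-- **In a configuration `ζ`, the pinned predicate `u ↦ (u ↔ o) ∧ C_u ∈ 𝓗` is closed under open reachability** (joined vertices have the
same open edge cluster). [folklore] -/
theorem pinPred_closed (ζ : Set (Sym2 V)) (o : V) (𝓗 : Set (Set (Sym2 V))) :
    ∀ a b, ((openGraph ζ).Reachable a o ∧ openEdgeCluster ζ a ∈ 𝓗) → (openGraph ζ).Reachable a b →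
      ((openGraph ζ).Reachable b o ∧ openEdgeCluster ζ b ∈ 𝓗) := by
  rintro a b ⟨hao, haH⟩ hab
  refine ⟨hab.symm.trans hao, ?_⟩
  rw [attachSet_openEdgeCluster_eq_of_reachable hab.symm]
  exact haH

/-- **EXCLUSIVITY (memo (E))**: two vertices whose clusters both pass the pinned test are joined (both are joined to `o`). [folklore] -/
theorem pinPred_exclusive (ζ : Set (Sym2 V)) (o : V) (𝓗 : Set (Set (Sym2 V))) :
    ∀ a b, ((openGraph ζ).Reachable a o ∧ openEdgeCluster ζ a ∈ 𝓗) → ((openGraph ζ).Reachable b o ∧ openEdgeCluster ζ b ∈ 𝓗) →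
      (openGraph ζ).Reachable a b :=
  fun _ _ ha hb => ha.1.trans hb.1.symm

/-- The pinned predicate of a configuration at `u` is membership in `pinEv o 𝓗 u`. [folklore] -/
theorem pinPred_iff_mem_pinEv (ζ : Set (Sym2 V)) (o : V) (𝓗 : Set (Set (Sym2 V))) (u : V) :
    ((openGraph ζ).Reachable u o ∧ openEdgeCluster ζ u ∈ 𝓗) ↔ ζ ∈ pinEv o 𝓗 u :=
  Iff.rfl

/-! ### The pinned decoy list agrees with the pure one off the label -/

/-- Off the label the pinned decoy constant is the pure one. [folklore] -/
theorem pAvoidConst_of_ne (w : Sym2 V → unitInterval) (o : V) (𝓗 : Set (Set (Sym2 V))) (d : V) (A : Set V) {u : V}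
    (hu : u ≠ o) : pAvoidConst w o 𝓗 d A u = avoidConst w d A u := by
  simp [pAvoidConst, hu]

/-- The decoys of `pDecoyList w o 𝓗 A D` are `D`. [folklore] -/
theorem map_fst_pDecoyList (w : Sym2 V → unitInterval) (o : V) (𝓗 : Set (Set (Sym2 V))) :
    ∀ (A : Set V) (D : List V), (pDecoyList w o 𝓗 A D).map Prod.fst = D
  | _, [] => rfl
  | A, d :: ds => by simp [pDecoyList, map_fst_pDecoyList w o 𝓗 (insert d A) ds]

/-- **The level forms of the pinned and of the pure decoy list agree at every genuine vertex** `u ≠ o`, on row functions agreeing off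
the label (the forms read the constants only at `u` and at the decoys, none of which is the label). [folklore] -/
theorem slForm_pDecoyList_of_ne (w : Sym2 V → unitInterval) (o : V) (𝓗 : Set (Set (Sym2 V))) :
    ∀ (D : List V) (A : Set V) (f g : V → ℝ), (∀ w', w' ≠ o → f w' = g w') → (∀ d ∈ D, d ≠ o) →
      ∀ u, u ≠ o → slForm (pDecoyList w o 𝓗 A D) f u = slForm (decoyList w A D) g u
  | [], A, f, g, hfg, _, u, hu => by simpa [pDecoyList, decoyList] using hfg u hu
  | d :: ds, A, f, g, hfg, hD, u, hu => by
      simp only [pDecoyList, decoyList, slForm_cons_eq]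
      refine slForm_pDecoyList_of_ne w o 𝓗 ds (insert d A) _ _ (fun w' hw' => ?_)
        (fun d' hd' => hD d' (List.mem_cons_of_mem _ hd')) u hu
      simp only [slStep]
      rw [hfg w' hw', hfg d (hD d List.mem_cons_self), pAvoidConst_of_ne w o 𝓗 d A hw']

/-- **The unfolded decoy terms of the pinned and of the pure decoy list agree at every genuine vertex** `u ≠ o` (for any row relation).
[folklore] -/
theorem unfoldT_pDecoyList_of_ne (R : V → V → Prop) (w : Sym2 V → unitInterval) (o : V) (𝓗 : Set (Set (Sym2 V))) :
    ∀ (D : List V) (A S : Set V), (∀ d ∈ D, d ≠ o) → ∀ u, u ≠ o →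
      unfoldT R S (pDecoyList w o 𝓗 A D) u = unfoldT R S (decoyList w A D) u
  | [], _, _, _, _, _ => rfl
  | d :: ds, A, S, hD, u, hu => by
      have hds : ∀ d' ∈ ds, d' ≠ o := fun d' hd' => hD d' (List.mem_cons_of_mem _ hd')
      simp only [pDecoyList, decoyList, unfoldT, unfoldT_pDecoyList_of_ne R w o 𝓗 ds (insert d A) (insert d S) hds u hu]
      congr 2
      exact slForm_pDecoyList_of_ne w o 𝓗 ds (insert d A) _ _
        (fun w' hw' => by rw [pAvoidConst_of_ne w o 𝓗 d A hw']) hds u hu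

end PinCSH

end Summit.CriticalPhenomena.PercolationContinuityZ3.Theorems

end
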